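import Summits.AtomisticToContinuum.Crystallization.Theorems.FrustratedLawDichotomyDRowsA15Template
import Summits.AtomisticToContinuum.Crystallization.Theorems.FrustratedLawDichotomyDRowsBccFibres

/-!
# DROWS-SOUND for the A15 chunk, piece (s1) II: the enumerated frame list and the kernel counting facts (both root classes)

decomp-a2c hand-2 g46 — structural share for `AperiodicFrustratedLawGap` (stmt-27623), class-D rows.  For a root `r` of the A15 frame, the
root-centred frame vectors of squared length `< 575` are ENUMERATED (not searched): `frameL r` = `b + 4k − r`, `b ∈ a15Basis`, `k ∈ [-8,8]³`,
filtered by `nsq < 575`, `≠ 0` (≈ 7·10³ points; every frame vector `v` with `v + r ∈ 4ℤ³ + basis`, `nsq v < 575` is of this form when the root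
has coordinates in `[0,3]` — `mem_frameL`).  This file: the enumeration, its dictionary with the `Finset` side of `…DRowsA15Template` (`mem_frameL`, `frameL_nodup`, `card_filter_a15Box`), the cheap
kernel facts (`nodup_H0/H1`, `H0_lt/H1_lt`, basis checks), and the two converters `fibres_of_histOK` / `cover_of_list` turning the per-root closed evaluations
(histogram agreement `H.all (look (histL (frameL r)) D == m)`, cover `∀ v ∈ frameL r, (nsq v).toNat ∈ H.map fst` — ≈ 80 s each by `decide +kernel`, supplied per
root class by the sequel files `…DRowsA15KernelX/Y`) into FIBRES / COVER on `a15Box r`.  Roots of record: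
class X `rX = (0,0,0)`, class Y `rY = (1,0,2)` (census's `hist 0 0 0` / `hist 1 0 2`).
-/

namespace Summit.AtomisticToContinuum.Crystallization.Theorems.FrustratedLawDichotomyDRowsA15Frame

open Summit.AtomisticToContinuum.Crystallization.Theorems.FrustratedLawDichotomyDRowsA15 (H0 H1 sNum sDen)
open Summit.AtomisticToContinuum.Crystallization.Theorems.FrustratedLawDichotomyDRowsBccTemplate (nsq nsq_nonneg)
open Summit.AtomisticToContinuum.Crystallization.Theorems.FrustratedLawDichotomyDRowsBccFibres (incr look histL look_histL)
open Summit.AtomisticToContinuum.Crystallization.Theorems.FrustratedLawDichotomyDRowsA15Template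
  (a15Basis inFrame inFrame_iff a15Box)

/-! ## §1 The enumeration -/

/-- the class-X root of record. -/
def rX : ℤ × ℤ × ℤ := (0, 0, 0)

/-- the class-Y root of record (census's `hist 1 0 2`). -/
def rY : ℤ × ℤ × ℤ := (1, 0, 2)

/-- the translation range `[-8, 8]`. -/
def kL : List ℤ := (List.range 17).map fun n : ℕ => (n : ℤ) - 8

/-- ★ the enumerated root-centred frame vectors of squared length `< 575`, nonzero: `b + 4k − r`, `b ∈ a15Basis`, `k ∈ [-8,8]³` (nested `flatMap`,
the shape that evaluates in the kernel). -/
def frameL (r : ℤ × ℤ × ℤ) : List (ℤ × ℤ × ℤ) :=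
  (kL.flatMap fun k1 => kL.flatMap fun k2 => kL.flatMap fun k3 => a15Basis.map fun b =>
      (b.1 + 4 * k1 - r.1, b.2.1 + 4 * k2 - r.2.1, b.2.2 + 4 * k3 - r.2.2)).filter
    fun v => decide (nsq v < 575 ∧ v ≠ 0)

/-! ## §2 The kernel facts (closed evaluations) -/

/-- (s1, NODUP X) the shells of the A15 `H0` are pairwise distinct. -/
private theorem nodup_H0_A15 : (H0.map Prod.fst).Nodup := by decide +kernel

/-- (s1, NODUP Y) the shells of the A15 `H1` are pairwise distinct. -/
theorem nodup_H1_A15 : (H1.map Prod.fst).Nodup := by decide +kernel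

/-- every booked shell is below `575`. -/
theorem H0_lt_A15 : ∀ Dm ∈ H0, Dm.1 < 575 := by decide +kernel

/-- every booked shell is below `575`. -/
theorem H1_lt_A15 : ∀ Dm ∈ H1, Dm.1 < 575 := by decide +kernel

/-- distinct basis points are distinct `mod 4` (componentwise). -/
theorem basis_mod4 : ∀ b ∈ a15Basis, ∀ b' ∈ a15Basis,
    (b.1 - b'.1) % 4 = 0 → (b.2.1 - b'.2.1) % 4 = 0 → (b.2.2 - b'.2.2) % 4 = 0 → b = b' := by decide

/-- basis coordinates lie in `[0, 3]`. -/
theorem basis_range : ∀ b ∈ a15Basis, (0 ≤ b.1 ∧ b.1 ≤ 3) ∧ (0 ≤ b.2.1 ∧ b.2.1 ≤ 3) ∧ (0 ≤ b.2.2 ∧ b.2.2 ≤ 3) := by decide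

/-- the basis list has no duplicates. -/
theorem basis_nodup : a15Basis.Nodup := by decide

/-! ## §3 The dictionary with `a15Box` -/

/-- membership in the translation range. -/
theorem mem_kL {a : ℤ} : a ∈ kL ↔ -8 ≤ a ∧ a ≤ 8 := by
  simp only [kL, List.mem_map, List.mem_range]
  constructor
  · rintro ⟨n, hn, rfl⟩; omega
  · rintro ⟨h1, h2⟩; exact ⟨(a + 8).toNat, by omega, by omega⟩

/-- `kL` has no duplicates. -/
theorem kL_nodup : kL.Nodup := (List.nodup_range).map fun x y h => by simpa using h

/-- a coordinate of a vector of squared length `< 575` is at most `23` in absolute value. -/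
theorem coord_le_of_nsq_lt {v : ℤ × ℤ × ℤ} (h : nsq v < 575) :
    (-23 ≤ v.1 ∧ v.1 ≤ 23) ∧ (-23 ≤ v.2.1 ∧ v.2.1 ≤ 23) ∧ (-23 ≤ v.2.2 ∧ v.2.2 ≤ 23) := by
  unfold nsq at h
  have h1 : v.1 * v.1 ≤ 574 := by nlinarith [mul_self_nonneg v.2.1, mul_self_nonneg v.2.2]
  have h2 : v.2.1 * v.2.1 ≤ 574 := by nlinarith [mul_self_nonneg v.1, mul_self_nonneg v.2.2]
  have h3 : v.2.2 * v.2.2 ≤ 574 := by nlinarith [mul_self_nonneg v.1, mul_self_nonneg v.2.1]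
  refine ⟨⟨?_, ?_⟩, ⟨?_, ?_⟩, ⟨?_, ?_⟩⟩ <;> nlinarith

/-- ★ for a root with coordinates in `[0,3]`, the enumerated list IS the set of nonzero root-centred frame vectors of squared length `< 575`. -/
theorem mem_frameL {r : ℤ × ℤ × ℤ} (hr : (0 ≤ r.1 ∧ r.1 ≤ 3) ∧ (0 ≤ r.2.1 ∧ r.2.1 ≤ 3) ∧ (0 ≤ r.2.2 ∧ r.2.2 ≤ 3)) {v : ℤ × ℤ × ℤ} :
    v ∈ frameL r ↔ inFrame (v.1 + r.1, v.2.1 + r.2.1, v.2.2 + r.2.2) = true ∧ v ≠ 0 ∧ nsq v < 575 := by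
  obtain ⟨v1, v2, v3⟩ := v
  simp only [frameL, List.mem_filter, List.mem_flatMap, List.mem_map, decide_eq_true_eq, inFrame_iff]
  constructor
  · rintro ⟨⟨k1, -, k2, -, k3, -, b, hb, h⟩, hlt, hne⟩
    simp only [Prod.mk.injEq] at h
    obtain ⟨h1, h2, h3⟩ := h
    refine ⟨⟨b, hb, by omega, by omega, by omega⟩, hne, hlt⟩
  · rintro ⟨⟨b, hb, h1, h2, h3⟩, hne, hlt⟩
    have hc := coord_le_of_nsq_lt hlt
    have hbr := basis_range b hb
    simp only at h1 h2 h3 hc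
    refine ⟨⟨(v1 + r.1 - b.1) / 4, mem_kL.mpr ⟨by omega, by omega⟩, (v2 + r.2.1 - b.2.1) / 4, mem_kL.mpr ⟨by omega, by omega⟩,
      (v3 + r.2.2 - b.2.2) / 4, mem_kL.mpr ⟨by omega, by omega⟩, b, hb, ?_⟩, hlt, hne⟩
    simp only [Prod.mk.injEq]
    refine ⟨by omega, by omega, by omega⟩

/-- the images of two different basis points under `b ↦ b + 4k − r` never coincide, and equal images force equal `k`. -/
theorem gen_inj {r : ℤ × ℤ × ℤ} {k1 k2 k3 k1' k2' k3' : ℤ} {b b' : ℤ × ℤ × ℤ} (hb : b ∈ a15Basis) (hb' : b' ∈ a15Basis)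
    (h : (b.1 + 4 * k1 - r.1, b.2.1 + 4 * k2 - r.2.1, b.2.2 + 4 * k3 - r.2.2) = (b'.1 + 4 * k1' - r.1, b'.2.1 + 4 * k2' - r.2.1, b'.2.2 + 4 * k3' - r.2.2)) :
    b = b' ∧ k1 = k1' ∧ k2 = k2' ∧ k3 = k3' := by
  simp only [Prod.mk.injEq] at h
  have hbb : b = b' := basis_mod4 b hb b' hb' (by omega) (by omega) (by omega)
  subst hbb
  exact ⟨rfl, by omega, by omega, by omega⟩

/-- the innermost block (fixed `k`) has no duplicates. -/
theorem block_nodup (r : ℤ × ℤ × ℤ) (k1 k2 k3 : ℤ) :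
    (a15Basis.map fun b : ℤ × ℤ × ℤ => (b.1 + 4 * k1 - r.1, b.2.1 + 4 * k2 - r.2.1, b.2.2 + 4 * k3 - r.2.2)).Nodup := by
  refine List.Nodup.map_on (fun b hb b' hb' h => (gen_inj hb hb' h).1) basis_nodup

/-- the enumerated list has no duplicates. -/
theorem frameL_nodup (r : ℤ × ℤ × ℤ) : (frameL r).Nodup := by
  refine List.Nodup.filter _ ?_
  rw [List.nodup_flatMap]
  refine ⟨fun k1 _ => ?_, ?_⟩
  · rw [List.nodup_flatMap]
    refine ⟨fun k2 _ => ?_, ?_⟩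
    · rw [List.nodup_flatMap]
      refine ⟨fun k3 _ => block_nodup r k1 k2 k3, ?_⟩
      refine kL_nodup.pairwise_of_forall_ne fun k3 _ k3' _ hne => ?_
      simp only [Function.onFun, List.disjoint_left, List.mem_map]
      rintro _ ⟨b, hb, rfl⟩ ⟨b', hb', h⟩
      exact hne (gen_inj hb hb' h.symm).2.2.2
    · refine kL_nodup.pairwise_of_forall_ne fun k2 _ k2' _ hne => ?_
      simp only [Function.onFun, List.disjoint_left, List.mem_flatMap, List.mem_map]
      rintro _ ⟨k3, -, b, hb, rfl⟩ ⟨k3', -, b', hb', h⟩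
      exact hne (gen_inj hb hb' h.symm).2.2.1
  · refine kL_nodup.pairwise_of_forall_ne fun k1 _ k1' _ hne => ?_
    simp only [Function.onFun, List.disjoint_left, List.mem_flatMap, List.mem_map]
    rintro _ ⟨k2, -, k3, -, b, hb, rfl⟩ ⟨k2', -, k3', -, b', hb', h⟩
    exact hne (gen_inj hb hb' h.symm).2.1

/-- ★ `Finset` counts over `a15Box r` of a shell below `575` are list counts over `frameL r` (root with coordinates in `[0,3]`). -/
theorem card_filter_a15Box {r : ℤ × ℤ × ℤ} (hr : (0 ≤ r.1 ∧ r.1 ≤ 3) ∧ (0 ≤ r.2.1 ∧ r.2.1 ≤ 3) ∧ (0 ≤ r.2.2 ∧ r.2.2 ≤ 3))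
    {D : ℤ} (hD : D < 575) :
    ((a15Box r).filter fun v => nsq v = D).card = ((frameL r).filter fun v => decide (nsq v = D)).length := by
  classical
  have hset : ((a15Box r).filter fun v => nsq v = D) = ((frameL r).filter fun v => decide (nsq v = D)).toFinset := by
    ext v
    simp only [Finset.mem_filter, List.mem_toFinset, List.mem_filter, decide_eq_true_eq, mem_frameL hr, a15Box,
      Finset.mem_product, Finset.mem_Icc]
    constructor
    · rintro ⟨⟨-, hfr, hne⟩, hD'⟩
      exact ⟨⟨hfr, hne, by rw [hD']; exact hD⟩, hD'⟩
    · rintro ⟨⟨hfr, hne, hlt⟩, hD'⟩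
      exact ⟨⟨by have := coord_le_of_nsq_lt hlt; exact ⟨⟨this.1.1, this.1.2⟩, ⟨this.2.1.1, this.2.1.2⟩, ⟨this.2.2.1, this.2.2.2⟩⟩, hfr, hne⟩, hD'⟩
  rw [hset, List.toFinset_card_of_nodup ((frameL_nodup r).filter _)]

/-- the class-X root has coordinates in `[0,3]`. -/
theorem rX_range : (0 ≤ rX.1 ∧ rX.1 ≤ 3) ∧ (0 ≤ rX.2.1 ∧ rX.2.1 ≤ 3) ∧ (0 ≤ rX.2.2 ∧ rX.2.2 ≤ 3) := by decide

/-- the class-Y root has coordinates in `[0,3]`. -/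
theorem rY_range : (0 ≤ rY.1 ∧ rY.1 ≤ 3) ∧ (0 ≤ rY.2.1 ∧ rY.2.1 ≤ 3) ∧ (0 ≤ rY.2.2 ∧ rY.2.2 ≤ 3) := by decide

/-! ## §4 ★ FIBRES and COVER from the kernel facts (supplied per root class by the sequel files) -/

/-- FIBRES from a histogram agreement. -/
theorem fibres_of_histOK {r : ℤ × ℤ × ℤ} (hr : (0 ≤ r.1 ∧ r.1 ≤ 3) ∧ (0 ≤ r.2.1 ∧ r.2.1 ≤ 3) ∧ (0 ≤ r.2.2 ∧ r.2.2 ≤ 3))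
    {H : List (ℕ × ℕ)} (hH : ∀ Dm ∈ H, Dm.1 < 575)
    (hok : (H.all fun Dm => look (histL (frameL r)) (Dm.1 : ℤ) == Dm.2) = true) :
    ∀ Dm ∈ H, ((a15Box r).filter fun v => nsq v = (Dm.1 : ℤ)).card = Dm.2 := by
  intro Dm hDm
  have hall := List.all_eq_true.mp hok Dm hDm
  simp only [beq_iff_eq] at hall
  have hlt : (Dm.1 : ℤ) < 575 := by exact_mod_cast hH Dm hDm
  rw [card_filter_a15Box hr hlt, ← hall, look_histL, List.countP_eq_length_filter]

/-- ★ COVER on the `Finset` side, class X / Y: a nonzero root-centred frame vector of the box with squared length `< 575` sits on a booked shell. -/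
theorem cover_of_list {r : ℤ × ℤ × ℤ} (hr : (0 ≤ r.1 ∧ r.1 ≤ 3) ∧ (0 ≤ r.2.1 ∧ r.2.1 ≤ 3) ∧ (0 ≤ r.2.2 ∧ r.2.2 ≤ 3))
    {H : List (ℕ × ℕ)} (hcov : ∀ v ∈ frameL r, (nsq v).toNat ∈ H.map Prod.fst) :
    ∀ v ∈ a15Box r, nsq v < 575 → (nsq v).toNat ∈ H.map Prod.fst := by
  intro v hv hlt
  have hv' := Finset.mem_filter.mp hv
  exact hcov v ((mem_frameL hr).mpr ⟨hv'.2.1, hv'.2.2, hlt⟩)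

end Summit.AtomisticToContinuum.Crystallization.Theorems.FrustratedLawDichotomyDRowsA15Frame
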